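import Literature.NumberTheory.EllipticCurves.LeadingTerm
import Literature.NumberTheory.EllipticCurves.Rank1Residual.Predicates
import HarnessLib

/-!
# Yan–Zhu 2026, Theorem 4.15 (= Corollary 1.4): the `p`-part of the BSD formula in analytic rank
# `≤ 1` at an odd good ordinary prime, any conductor, under (irr) + (Im)

Source: Xiaojun Yan, Xiuwu Zhu, *Main conjectures for non-CM elliptic curves at good ordinary
primes*, J. Algebra (2026), doi:10.1016/j.jalgebra.2026.01.016 (= arXiv:2412.20078), §1.1
Corollary 1.4 and §4.6 Theorem 4.15 (bib key `YanZhu2024MainConjNonCM`, the key already used by the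
tree's `p`-converse files `BSDSelmerPConverseYanZhu*`).

ARXIV-VERSION NOTE (2026-08-23; lit GEN 98 `HOME/b2b-bsdres-lit/g98/DRIFT-READS.md` §F1, GLUE seat
gen 12): the text this file read (`paper:arxiv-2412.20078`) is arXiv **v2** (2025-01-03); every
section/theorem number and page quoted in this file ("§4.4–4.6", "Thm. 4.15", "Thm. 4.9", "p. 11")
is a v2 number. In the CURRENT text arXiv v3 ≡ **v4** (2026-01-23, the revision carrying the journal
DOI; J. Algebra **693** (2026) 372–402) the concordance is: Cor. 1.4 = Cor. 1.4; Thm. 4.15 → **Thm.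
5.11** (§5.3); Thm. 4.9 → Thm. 5.2 (§5.1); Thm. 4.12/4.13/4.14 → Thm. 5.7/5.8/5.9 (§5.2); Thm. 4.2,
Thm. 4.7 unchanged; Rem. 1.3 rewritten. The statement vendored here (last clause of Thm. 4.15 = Thm.
5.11 = Cor. 1.4: "if (Im) also holds, then the `p`-part of the BSD formula holds") is UNCHANGED IN
CONTENT between v2 and v4 (lit GEN 98 diff read: CLEARED, locator drift only). What changed is the
rank-one leg of its PROOF: v4 proves it "from the integral part of Corollary 5.4 [cyclotomic analogue
of the BDP main conjecture, integral under (Im)], [CGS, Proposition 3.4.2], the fact that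
`𝓛_p^Gr(E/K)⁺(1) = 𝓛_p^Gr(E/K)⁻(1) ≠ 0`, and the descent arguments in [JSW]" (v4 TeX l.1347) instead of
v2's "(the integral part of) Theorem 4.12" — whose v4 form, Thm. 5.7, carries the integral clause
under full `p`-adic image of `G_K` (the (Im) form being Rem. 5.10 via the preprint [BSTW, Prop.
12.7]); see `YanZhu2026/CyclotomicBDPCorollaryAtTrivialCharacter.lean`. Castella–Grossi–Skinner
numbers quoted below ("Prop. 3.2.1", "Thm. 5.5.2") are arXiv:2303.04373v1's; in v2 = Math. Ann. 393
(2025) they are Prop. 4.2.1 and Thm. 6.5.2 (lit GEN 98 §F2).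

This file states, as a NAMED FACT (`def … : Prop`, D-0014), the last clause of Theorem 4.15 — the
`p`-part of the Birch–Swinnerton-Dyer formula for `E/ℚ` of analytic rank `r ≤ 1` at a prime
`p > 2` of good ordinary reduction with `ρ̄_{E,p}` irreducible, under the image condition

  (Im) there exists `τ ∈ Gal(ℚ̄/ℚ(μ_{p^∞}))` such that `T_pE/(ρ_E(τ)-1)T_pE` is free of `ℤ_p`-rank one,

with NO condition on the conductor `N` beyond `p ∤ 2N`. Its interest for the tree is the prime
`p = 3`: every other published `p`-part theorem without an auxiliary "ramified multiplicative
prime" (Burungale–Castella–Skinner, IMRN 2025, Cor. 1.3.1; W. Zhang, Camb. J. Math. 2 (2014),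
Thm. 1.6; Castella, Camb. J. Math. 6 (2018), Thm. A) is printed for `p > 3` / `p ≥ 5`, and
Jetchev–Skinner–Wan, Camb. J. Math. 5 (2017), Thm. 1.2.1 allows `p = 3` only for semistable `E`.

## The image condition (Im) in tree vocabulary (special case; `-- TODO(general form)` below)

The tree has no vocabulary for (Im) (cf. the TODO in `CyclotomicIwasawaMainTheoremIrreducible`,
Burungale–Castella–Skinner Thm. 1.1.2 (b)). The fact is therefore stated under the disjunction
`hIm` of two tree-expressible conditions each of which IMPLIES (Im), so that it is a special case of
(never stronger than) the printed theorem: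
* `ρ_{E,p} : G_ℚ → GL₂(ℤ_p)` surjective, spelled `∀ n, W.HasSurjectiveModNGaloisRep (p ^ n)` exactly
  as in clause 3 of bsd.S20 `kato_divisibility` / bsd.S21 `skinner_urban_main_conjecture`: then
  `ρ_E(G_{ℚ(μ_{p^∞})}) = SL₂(ℤ_p) ∋ (1 1; 0 1) =: τ` and `T/(τ-1)T ≅ ℤ_p`;
* (ram) "there is a prime `ℓ ≠ p` of multiplicative reduction with `E[p]` ramified at `ℓ`"
  (`p ∤ v_ℓ(Δ_min)`, Tate), spelled as in bsd.S30: then (Im) holds with `τ` a generator of tame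
  inertia at `ℓ` — C. Skinner, Pacific J. Math. 283 (2016), §2.5 (after Thm. 9): "`ρ_f(τ)` is
  unipotent for any `τ ∈ I_q` projecting to a topological generator of the tame quotient and,
  since `ρ̄_f` is ramified at `q`, `ρ̄_f(τ) ≠ 1`, hence `T_f/(ρ_f(τ)-1)T_f` is a free `𝒪`-module
  of rank one. As `τ ∈ Gal(ℚ̄/ℚ[μ_{p^∞}])`, condition (b) holds for `g = τ`." Yan–Zhu themselves
  point to this passage (§4.3, last sentence: "the condition `Im(ρ_E) ⊃ SL₂(ℤ_p)` is used, but it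
  can be replaced by (Im) as discussed in the last paragraph of [ski2016]").

## Status notes recorded for reviewers (PUB, with located caveats)

The paper is refereed and published (J. Algebra, accepted 2026-01). Its proof cites: Skinner–Urban
2014 (Thm. 7.7, Prop. 13.6 (1); `p` odd), Hida theory, Rohrlich 1984, Kato 2004, Skinner 2016 §2.5,
Hsieh, Doc. Math. 19 (2014) (`μ = 0` for the BDP `p`-adic `L`-function; `p` odd),
Castella–Grossi–Skinner, Math. Ann. 393 (2025) (Thm. 4.13 here; Prop. 3.2.1 there for the
Beilinson–Flach equivalence of two-variable main conjectures, `p > 2`), Burungale–Castella–Kim,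
Algebra Number Theory 15 (2021) (printed for `p > 3`; used "similarly" for Thm. 4.14, the
BDP ↔ Heegner-point equivalence entering only the rank-one leg), and the PREPRINT
Burungale–Skinner–Tian–Wan arXiv:2409.01350 ("Similarly, as [BSTW] (see also [CGS]), the following
theorem holds" for Thm. 4.7; "See the proof in [BSTW] for details" at the end of §4.5). The
printed hypotheses of Thm. 4.15 / Cor. 1.4 are `p ∤ 2N`, good ORDINARY reduction at `p`,
`r ≤ 1`, and (Im) for the integral statement; irreducibility of `ρ̄_{E,p}` is the standing
assumption of §4.4–§4.6 (p. 11: "Suppose that the residue representation `ρ̄_E` … is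
irreducible") under which Thm. 4.9 (Mazur's main conjecture, used in the proof) is stated, and is
therefore kept as an explicit hypothesis here (never weaker than the source).

Cell flag (b2b-bsdres referee rulings R9.1/R10.1, FINAL wording; it supersedes the provisional
names `YZ26-BF-equiv` and `YZ26@3-r1-BCK-analogy` used when this file landed, the latter being
RETIRED because the Howard-type input of the rank-one leg is Castella–Grossi–Skinner 2025 Thm. 5.5.2,
published at `p ∤ 2N`): `YZ26@3-BF-ERL-Ohta` — "Thm. 4.7 (Beilinson–Flach equivalence): statement
in print at `p ∤ 2N` (Burungale–Castella–Skinner, IMRN 2025, Thm. 4.1.3; Castella–Grossi–Skinner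
2025, Prop. 3.2.1; Yan–Zhu 2026, Thm. 4.7); every printed proof pointer → BSTW §9.3.2 / BST
(preprints); the explicit reciprocity laws in Hida families are printed for `p ≥ 5` only
(Kings–Loeffler–Zerbes 2017 §7.2, Lei–Loeffler–Zerbes 2015 §1.1/§5.3, Fukaya–Kato 2024); at `p = 3`
the `Λ`-adic Eichler–Shimura input rests on Sangiovanni Vincentelli–Skinner (preprint): Cais,
Compositio 154 (2018), Cor. 15/16 covers only the closed-curve (cuspidal) row of BSTW Thm. 3.1, not
the open-curve row used at the Eisenstein prime (referee F23)". The statement below is the REFEREED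
statement, valid as printed at every `p > 2`; the flag concerns one proof-level input at `p = 3` and
is not a claim that anything is false (second-level audit: HOME/X10-AUDIT.md §8).
RE-WORDED 2026-08-26 (referee C = pub-bsdpct-r3, ROUND 361 (δ): the flag is CONFIRMED and the two-prong
string of reader 2's ADDENDUM-1 §4 — merging reader 1's §5 — is GRANTED; it supersedes the
single-input `p = 3` clause of the string above for ORDINARY rows; statement-level tier PUB*
unchanged; row D3 stays literal, 0 of 4 814 moved), verbatim: `YZ26@3-BF-ERL-Ohta` := "BF equivalence
(YZ Thm 4.7 = [BSTW Prop 9.18] = v2 II.1.18; CGS Prop 4.2.1; BCS Thm 4.1.3): logic refereed/PASS-in-cell;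
its explicit reciprocity laws (BSTW I Thms 4.5/4.7 ⇐ KLZ17 Thm B) need BSTW Thm 3.1–3.2 at p = 3, whose
control/freeness/pairing rows are refereed at 3 (Hida EMI 2022 Thm 4.2.37; Cais 2018 II for the closed
curve on the non-trivial μ₂-component) but whose Λ-adic Eichler–Shimura rows are not: (G1/G♯) f_E's
Hida family, trivial μ₂-component — no source at 3 (Cais excludes ω⁰; [Oht00]/[FK24] p ≥ 5;
[SV-S-Ohta] invoked by BSTW Rem 5.1 under non-trivial central character); (G2/G♭) CM family 𝐡_v,
open curve at its Eisenstein ideal — [SV-S-Ohta] PRE (unlocated 2026-08-26), Cais = closed curve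
only". STRIKE TEST of record (R361.3 (ε), mechanical, row-dependent prong map for referee A): a future
refereed text strikes the node for an ORDINARY row (D3) iff it prints at `p = 3` BOTH (i) the
`ω⁰`-component for tame level `N ≥ 4` prime to `3` (closed curve at a non-Eisenstein maximal ideal
suffices) and (ii) the open curve `Y₁(D_K·3^∞)` at the Eisenstein ideal of `𝐡_v`; a text printing (ii)
only strikes the supersingular rows' node and nothing of D3. The second-order pointer `YZ26@3-HidaRS` is
CITATION HYGIENE, not a flag component (R361.3 (γ); Hida, Ann. Inst. Fourier 41 (1991): "We fix a
rational prime p").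

Nothing is asserted: users take `(h : thm415_padicValRat_bsd_rank_le_one)`; no `_holds` is
expected.

## v4 READING OF RECORD and kernel status of the (Im) witnesses (cell `bsd-litref`, paper sub-dir
## `yz26`, typer seat `bsd-litref-yz26-ty`, 2026-08-26; programme BSD-LIT2PART-PROGRAMME-v1 §T2, row D3)

Docstring-only addendum; both statements below are byte-identical to p177386 / p177554. Read on the
v4 TeX of record (`pub/pub-bsdres/b2b-bsdres-lit/g98/eprints/yz_v4/main.tex`, e-print sha256
`2ebe33f2…fb40`; `lit read` of the DOI or of `arxiv:2412.20078v4` returns the v2 store text — quote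
v4 from that TeX), binder by binder (HOME `run/shared/lean/pub/bsd-litref/yz26/staging/bsd-litref-yz26-ty/PRE-AUDIT.md`):
1. v4 Thm. 5.11 (§5.3, TeX l.1317–1332) and Cor. 1.4 (l.384–391) print NO irreducibility hypothesis
   in their own sentences; (irr) is the abstract's global assumption (l.272: "Assume that the residual
   Galois representation associated with `(E, p)` is irreducible") and the standing hypothesis of §5.1
   (l.1061–1062) under which the proof's inputs Thm. 5.2 / Cor. 5.4 are stated. The binder `hirr` is
   KEPT: the facts below are thereby weaker than the §5.3 sentence and equal to what the printed proof
   delivers (never stronger than the source).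
2. The two (Im)-witnesses of the special-case binder are now KERNEL THEOREMS of the tree
   (Summits-side, not importable here): `Summit.BirchSwinnertonDyer.Rank1Residual.X9.bigIm_of_hasSurjectiveModNGaloisRep_pow`
   (every `p`: `p`-adic surjectivity ⟹ (Im)) and `…X9.bigIm_of_irr_of_ram` (every `p`: (irr) ∧ (ram)
   ⟹ (Im)); hence `thm415_padicValRat_bsd_rank_le_one` FOLLOWS from the verbatim form
   `thm415_padicValRat_bsd_rank_le_one_of_bigIm` in the kernel —
   `Summit.BirchSwinnertonDyer.Rank1Residual.yanZhu_thm415_of_thm415_of_bigIm`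
   (`Summits/…/Rank1Residual/Partition/YanZhuImForm.lean`, p454928, seat `bsd-litref-yz26-pv`), and on
   row C16 (= D3) every class has `ρ_{E,3}` onto `GL₂(ℤ₃)` granted Wuthrich 2014 Lemma 20
   (`RowC16.threeAdicSurjective`, `RowC16.bigIm`). The sentence "not yet tree theorems" in the
   docstring of `…_of_bigIm` below is superseded by this item.
3. v4 wording of the flagged input (the flag `YZ26@3-BF-ERL-Ohta` is unchanged in content): Thm. 4.7
   (TeX l.1022–1034) "Proof. This result is essentially [BSTW, Proposition 9.18] in the two-variable
   (or `· = ∅` in loc. cit.) case, building on explicit reciprocity laws for the Beilinson-Flach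
   classes and global Poitou-Tate duality. See also [BCS, Proposition 4.1.3] and [CGS, Proposition
   4.2.1]." — at `p = 3` the reciprocity laws rest on the `Λ`-adic Eichler–Shimura theorem BSTW
   arXiv:2409.01350v2 Thm. 3.1, printed there with "For `p ≥ 5`, this theorem is explained in [FK].
   It is also proved in [Oh1,Oh2] … The arguments in these papers likely apply to the `p = 3` case as
   well. The results of [Ca] explicitly covers some parts of the `p = 3` cases. An alternate proof that
   also includes the `p = 3` case is included in [SV-S-Ohta]" and Rem. 5.1; [SV-S-Ohta] =
   Sangiovanni Vincentelli–Skinner, *A generalization of Ohta's theorem for holomorphic automorphic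
   forms*, NOT PUBLIC on 2026-08-26 (arXiv / zbMATH / internal corpora: no text; cited as "preprint"
   in arXiv:2510.04301 = Res. Number Theory (2026)). D-AUDIT SHEETS OF RECORD (cell `bsd-litref/yz26`,
   two independent readers: `sheets/D-AUDIT-yz26-r1.md` sha16 `afcaff78c72f86dd` and
   `sheets/D-AUDIT-T2c-yz26-r2.md` sha16 `156794b7540493ec`, 2026-08-26, both SEALED, each with one
   post-seal ADDENDUM-1 — `sheets/D-AUDIT-yz26-r1-ADDENDUM-1.md` sha16 `ed8bed88180f8d5e` and
   `sheets/D-AUDIT-T2c-yz26-r2-ADDENDUM-1.md` sha16 `2075b9099f88ace7` (r1↔r2 concordance item by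
   item; the WIDTH of the gap settled at the page from both sides: KLZ17 Prop. 7.2.1 (1)(4) —
   `Λ_D`-projectivity and perfect control, on every `μ₂`-component — is refereed print at every `p` by
   Hida, *Elementary Modular Iwasawa Theory* (2022), Thm. 4.2.37 (with Cor. 4.2.22 for the closed
   curve), and the `Λ_D`-pairing of BSTW Thm. 3.2 is formal given that freeness (Poincaré duality at
   finite level; for `𝐡_v`'s component also Cais 2018 II Thm. 3, `p > 2`), so the residual is EXACTLY
   the `Λ`-adic Eichler–Shimura/structure package KLZ17 Thm. 7.2.3 + Thm. 9.5.1 / Prop. 10.1.1 at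
   `(3, ω⁰)` for `f_E`'s family and at `(3, ω⁻¹)`, Eisenstein-inclusive, for `𝐡_v`;
   on row D3 irr(3) ∧ ram(3) ⇒ surj(3) (Serre 1972 Prop. 15), so EVERY D3 class is surj(3); the minor
   pointer `YZ26@3-HidaRS` is citation hygiene only — Hida, Ann. Inst. Fourier 41 (1991) fixes an
   arbitrary prime `p`); all four filed as WAKE-AUDIT-…-yz26-* to the D-audit desk (referee C2 =
   pub-bsdpct-r4 until 2026-08-26T19:22Z, thereafter referee C = pub-bsdpct-r3); the readers CONCUR;
   referee C's ruling: R361 (2026-08-26T21:22:43Z, yz26 GROUP RULING on all four wakes): «STATEMENT VERBATIM ×2 CONCUR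
   (desk PC/NC conforming); HYPOTHESES MET with both addenda sharpenings ADOPTED; PROOF INPUTS AT 3:
   GAP(BSTW p0029:L7) CONFIRMED at ONE node with TWO prongs G♯ ∧ G♭ — both prongs re-found at this desk on
   its own pages; flag re-wording GRANTED (two-prong); row D3 stays LITERAL, 0 of 4 814 cells move» —
   with, in R361.3: (α) statement PASS, no typer action owed; (β) every D3 class surj(3), the silent
   (Im)(E^K) step DISCHARGED BY KERNEL THEOREM BY NAME (p462273/p460172); (γ) width resolution ADOPTED
   (EMI Thm. 4.2.37: rows (a)(c) dischargeable by locator, the gap is EXACTLY the ES rows (b) = G♯ ∧ G♭),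
   BSTW II Prop. 1.18 logic PASS-in-cell ×2, `YZ26@3-HidaRS` downgraded to citation hygiene; (δ) typing
   divergence ruled T0 BY NAME as the lead ruled (reader 2's tier scratch stays STAGED, rc 0 at the desk);
   (ε) a register-wide ROW-DEPENDENT PRONG MAP + STRIKE TEST for referee A (ordinary rows — D3, D4@3,
   A10-ordinary — engage G♭ ∧ G♯; supersingular rows G♭ only); referee A: not seized of any move — GAP(line) ⇒ 0 move; the record note (re-wording + prong map + acq-11255 correction + p454928) is the lead's PRICING-D3-YZ26-v1 (sha16 8dbaebf5a815cdf8) filed to A 2026-08-26T21:25Z, round pending (cell lead rulings 21:02:36Z / 21:25:52Z) — the rulings price the flag and change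
   nothing below): statement VERBATIM, hypotheses-as-used MET on row D3, BSTW II Prop. 1.18 (the
   equivalence LOGIC; refereed twin CGS Math. Ann. Prop. 4.2.1) PASS-in-cell, and the `p = 3`
   Eichler–Shimura node **GAP(BSTW p0029:L7)** with TWO prongs, which SUPERSEDE the one-prong sentence
   of the "Cell flag" paragraph above ("at `p = 3` the `Λ`-adic Eichler–Shimura input rests on
   Sangiovanni Vincentelli–Skinner (preprint): Cais … covers only the closed-curve (cuspidal) row"):
   (G1 = reader 2's G♯) the Hida family `𝐠 ∋ g_α = f_E^α` on the E-side — BSTW Thm. 4.5 uses KLZ17's `η_𝐚` for "the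
   (new, cuspidal) branch `𝐚` of the Hida family `𝐠` containing the `p`-stabilization `g_α`"
   (arXiv:2409.01350v2 §4.3), and at `p = 3` that family lies on the TRIVIAL `μ₂`-component of
   `Λ_D = ℤ₃⟦ℤ₃^×⟧` (weight `2`, trivial character), which Cais, Compositio 154 (2018) (sub-idempotent
   `e*′`: "the part where `μ_{p−1} ⊆ ℤ_p^×` acts non-trivially") and Ohta 1995/1999 (`e′ = ⊕_{i ≢ 0,−1}`)
   EXCLUDE — no printed source at `3`; (G2 = reader 2's G♭) the canonical CM family `𝐡_v` (tame level `D_K`,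
   component `ω^{−1}`, inside `e*′`) is residually `𝟙 ⊕ χ_K`, so its Tate lattice needs the OPEN-curve
   row `𝓗¹_ord(D_K p^∞)` of BSTW Thm. 3.1 (ii) — Cais 2018 covers the closed-curve `e*′` statements at
   `p = 3` only; the rest is [SV-S-Ohta]. Everything KLZ17 §§7–10 / Ohta 1995–2000 / Fukaya–Kato
   (Kyoto J. Math. 64 (2024), §0.26) print is `p ≥ 5`. Not DISPUTED (no falsity claimed); the
   statement-level grade PUB* is unchanged; row D3 stays literal on this token (0 of 4 814 moved).
   Typed target of record for the gap, BY NAME and without a new declaration (the Λ-adic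
   modular-forms tower is below tree vocabulary): what the node delivers to row C16 in tree currency —
   `MazurMainConjecture W 3` (`Summit.BirchSwinnertonDyer.BirchSwinnertonDyer.Theorems.Rank1ResidualX1Defs`,
   `@[conjecture]`; r = 0; PROVED consumer `RowC16.bsdp_rankZero_of_mazurMainConjecture`) and the body of
   `cor54_prop342_thm513_generator_constantCoeff` at `3` (r = 1; PROVED consumer
   `RowC16.bsdp_of_publishedFacts_of_identityLink_of_cor54`); one statement level up, the tree now also
   names Thm. 4.2 (1) itself — `YanZhu2026.thm42_XOrd₂_isTorsion_charIdeal_le_perrinRiou`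
   (`YanZhu2026/TwoVariableMainTheorems.lean`, p465644, cell `bsd-littype`, 2026-08-26), the node between
   Thm. 5.2 and Thm. 4.7 whose printed proof carries G1 + G2 at `p = 3` (Thm. 4.7 stays untyped: no
   `𝓛_p^II` carrier yet). Print nit (sheet §1, number-neutral):
   v4 l.1149 cites "[Kato, Theorem 17.14]" for Kato's divisibility — Kato's §17 has no 17.14 (17.13 is
   the proof of 17.4); read Thm. 17.4, as v4 l.1053 does.
4. v4 re-routes the rank-one leg of the proof of Thm. 5.11 (l.1347) through Cor. 5.4, whose proof
   (l.1182–1184) cites "[CGS, Proposition 4.2.1] (a cyclotomic analogue of Theorem 4.7, see also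
   [BSTW, Proposition 9.18])" ← Castella–Grossi–Skinner, Math. Ann. 393 (2025) Thm. 4.1.1 "proved in
   [BSTW23, §5]" (the node the cell records as `CGS25-BST-Thm311` on row D4): on the `r = 1` rows of
   D3 that dependence rides as PROVENANCE (same `p = 3` Eichler–Shimura item underneath), not as a
   second flag token; the `r = 0` leg (Thm. 5.2 ⇐ Thm. 4.2 ⇐ Thm. 4.7) meets the item once.
5. (Im) for the twist `E^K` in the v4 proof of Thm. 5.2 (l.1139–1164, Kato's theorem "even in `Λ_ℚ`
   under the condition (Im)" applied to `E` AND `E^K`) is left implicit in print; it holds at odd `p`: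
   for `τ` as in (Im), `det ρ_E(τ) = 1` and `1` is an eigenvalue, so `ρ_E(τ) = 1 + N`, `N² = 0`,
   `ρ_E(τ²) − 1 = 2N`, and `τ² ∈ G_K ∩ G_{ℚ(μ_{p^∞})}` with `ρ_{E^K}(τ²) = ρ_E(τ²)` witnesses (Im)
   for `E^K` (any quadratic `K`; reader 2's B5) — now a KERNEL THEOREM for every elliptic curve over
   `ℚ`, every odd `p` and every `d ∈ ℚ^×` (cited BY NAME; Literature does not import Summits):
   `Summit.BirchSwinnertonDyer.Rank1Residual.bigIm_quadraticTwist_iff` / `…bigIm_twist_of_bigIm`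
   (`Summits/…/Rank1Residual/Partition/YanZhuImTwistStable.lean`, p462273, seat `bsd-litref-yz26-pv`),
   and on row C16 `…RowC16.bigIm_twist` / `…RowC16.towerSurj_twist` (`Partition/YanZhuTwistImage.lean`,
   p460172: every quadratic twist of a D3 class has `ρ_{E^{(d)},3}` onto `GL₂(ℤ₃)`, granted Wuthrich
   2014 Lemma 20); reader 2's ADDENDUM-1 §0 withdraws B5's caveat accordingly. Likewise silent in print (reader 2's B6): the auxiliary
   `K` of the proof of Thm. 5.2 / Thm. 5.11 must also meet §3.5's standing "`D_K` odd, `D_K ≠ −3`"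
   (l.882) for Prop. 3.14 / Hsieh to apply — infinitely many such `K`; harmless.

## References

* X. Yan, X. Zhu, J. Algebra 693 (2026), doi:10.1016/j.jalgebra.2026.01.016; numbers as read in
  arXiv:2412.20078v2: Cor. 1.4 (§1.1), Thm. 4.15 (§4.6), Thm. 4.2/4.7/4.9/4.12/4.14, Remark 1.3
  (= v4 / journal: Cor. 1.4, Thm. 5.11 (§5.3), Thm. 4.2/4.7/5.2/5.7/5.9, Remark 1.3 rewritten; see the
  ARXIV-VERSION NOTE).
* C. Skinner, Pacific J. Math. 283 (2016), §2.5 ((ram) ⇒ (Im)).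
* C. Skinner, E. Urban, Invent. Math. 195 (2014); K. Kato, Astérisque 295 (2004), Thm. 13.4 (3).
-/

noncomputable section

open scoped Classical

open WeierstrassCurve

namespace Literature.NumberTheory.EllipticCurves.YanZhu2026

/-- **Yan–Zhu, J. Algebra (2026), Theorem 4.15 (= Cor. 1.4), last clause — the `p`-part of BSD
in analytic rank `≤ 1` at an odd good ordinary prime under (irr) + (Im).** As printed (§4.6):
"Let `E/ℚ` be an elliptic curve of conductor `N`, `p > 2` a prime such that `E` has good
ordinary reduction at `p`. Theorem 4.15. For an integer `r ≤ 1`, the following are equivalent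
(1) `rank_ℤ E(ℚ) = r` and `#Ш(E/ℚ) < ∞`, (2) `corank_{ℤ_p} Sel_{p^∞}(E/ℚ) = r`,
(3) `ord_{s=1} L(E/ℚ,s) = r`. Under any of the above, if (Im) also holds, then `p`-part BSD
formula for `E` holds, i.e.,
`|L^{(r)}(1,E)/(r!·Ω_E R_E)|_p = |#Ш(E)[p^∞]·∏_{ℓ∣N} c_ℓ(E)/(#E(ℚ)_tor)²|_p`, where `R_E` is
the regulator of `E(ℚ)`, `Ω_E` the Néron period, `c_ℓ(E)` the Tamagawa number at a prime `ℓ`,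
and `|·|_p` the `p`-adic absolute value" — with (Im): "there exists
`τ ∈ Gal(ℚ̄/ℚ(μ_{p^∞}))` such that `T_pE/(ρ_E(τ)-1)T_pE` is free of `ℤ_p`-rank one" (display
(Im), §1.1), and under the standing hypothesis of §4.4–4.6 "the residue representation
`ρ̄_E : G_ℚ → Aut(E[p])` is irreducible" (`hirr`). Cor. 1.4 (§1.1) prints the same with
"`p ∤ 2N` a prime. Assume that `E` has ordinary reduction at `p`".
Transcription: `W` a globally minimal model of `E`; `p ≥ 3` (`hp`) with good (`hgood`) ordinary
(`hord : p ∤ a_p`) reduction; `r = W.analyticRank ≤ 1` (`hr`, hypothesis (3));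
(Im) in the SPECIAL CASE `hIm` (either `ρ_{E,p}` is surjective — all `ρ̄_{E,p^n}` surjective, as
in bsd.S20/S21 clause 3 — or there is a multiplicative prime `ℓ ≠ p` with `p ∤ v_ℓ(Δ_min)`, which
gives (Im) by Skinner 2016 §2.5; see the module docstring); conclusion: `Ш(E/ℚ)` is finite
((3) ⇒ (1)) and `L^{(r)}(E,1)/r! = W.leadingLCoeff` equals `q · Reg(E/ℚ) · Ω_E` for a rational `q`
(for `r ≤ 1` this rationality is Gross–Zagier's) with
`ord_p q = ord_p #Ш(E) + ord_p ∏_ℓ c_ℓ - 2 ord_p #E(ℚ)_tors` (`W.shaOrder` is the genuine order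
as `Ш` is finite, and `ord_p #Ш = ord_p #Ш[p^∞]`; `W.tamagawaProduct = ∏_{ℓ∣N} c_ℓ` since
`c_ℓ = 1` at good `ℓ`; `Reg(E/ℚ) = W.regulator`, `Ω_E = W.realPeriodRat` includes the number of
real components, immaterial at odd `p`).
-- TODO(general form): the printed hypothesis is (Im) itself (no tree vocabulary for
-- `T_pE/(ρ_E(τ)-1)T_pE ≅ ℤ_p` with `τ ∈ G_{ℚ(μ_{p^∞})}`); `hIm` is a sufficient condition for it.
((ram) ⇒ (Im): Skinner, Pacific J. Math. 283 (2016), §2.5, after Thm. 9.)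
[cite: YanZhu2024MainConjNonCM, Thm. 4.15 (§4.6) = Cor. 1.4 (§1.1)] -/
def thm415_padicValRat_bsd_rank_le_one : Prop :=
  ∀ (W : WeierstrassCurve ℚ) [W.IsElliptic] [W.IsGloballyMinimal] (p : ℕ) [Fact p.Prime]
    (_hp : 3 ≤ p) (_hgood : W.HasGoodReductionAtPrime p) (_hord : ¬ (p : ℤ) ∣ W.frobeniusTrace p)
    (_hirr : W.HasIrreducibleModPGaloisRep p)
    (_hIm : (∀ n : ℕ, W.HasSurjectiveModNGaloisRep (p ^ n : ℕ)) ∨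
      (∃ ℓ : ℕ, ∃ _ : Fact ℓ.Prime, ℓ ≠ p ∧ W.HasMultiplicativeReductionAtPrime ℓ ∧
        ¬ p ∣ padicValInt ℓ W.minimalDiscriminantInt))
    (_hr : W.analyticRank ≤ 1),
    Finite W.sha ∧
      ∃ q : ℚ, W.leadingLCoeff = (((q : ℝ) * W.regulator * W.realPeriodRat : ℝ) : ℂ) ∧
        padicValRat p q = (padicValNat p W.shaOrder : ℤ) + padicValNat p W.tamagawaProduct -
          2 * padicValNat p W.torsionOrder

/-- **Yan–Zhu, J. Algebra (2026), Theorem 4.15 (= Cor. 1.4), last clause — GENERAL printed form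
over the image condition (Im) itself**, now expressible by the cell's predicate
`Literature.NumberTheory.EllipticCurves.Rank1Residual.BigIm W p` ("there exists
`τ ∈ Gal(ℚ̄/ℚ(μ_{p^∞}))` such that `T_pE/(ρ_E(τ)-1)T_pE` is free of `ℤ_p`-rank one": `τ ∈ Γ_ℚ`
fixing every `p`-power root of unity of `ℚ̄`, with
`W.tateModule p ⧸ range(ρ(τ) - 1) ≃ₗ[ℤ_p] ℤ_p`; file `Rank1Residual/Predicates`). Verbatim source
text and transcription conventions exactly as in `thm415_padicValRat_bsd_rank_le_one` above (same
§4.6 quotation: "`p > 2` a prime such that `E` has good ordinary reduction at `p` … Under any of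
the above, if (Im) also holds, then `p`-part BSD formula for `E` holds, i.e.,
`|L^{(r)}(1,E)/(r!·Ω_E R_E)|_p = |#Ш(E)[p^∞]·∏_{ℓ∣N} c_ℓ(E)/(#E(ℚ)_tor)²|_p`"; standing
irreducibility of `ρ̄_{E,p}`, §4.4), with the hypothesis `hIm : BigIm W p` in place of the
special-case disjunction — this resolves that declaration's `TODO(general form)`; the special
case follows from this one granted the two published implications "`ρ_{E,p}` surjective ⇒ (Im)"
(Serre) and "(ram) ⇒ (Im)" (Skinner 2016 §2.5) — both now KERNEL THEOREMS Summits-side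
(`X9.bigIm_of_hasSurjectiveModNGaloisRep_pow`, `X9.bigIm_of_irr_of_ram`), the implication of facts
itself being `Summit.BirchSwinnertonDyer.Rank1Residual.yanZhu_thm415_of_thm415_of_bigIm`
(p454928; module docstring, v4 READING OF RECORD, item 2). Status notes
(refereed; proof cites the preprint BSTW arXiv:2409.01350 for Thm. 4.7 "as [BSTW] (see also
[CGS])" and, on the rank-one leg, "similarly to [BCK]" printed for `p > 3` — cell flag
`YZ26@3-BF-ERL-Ohta`, final wording of referee rulings R9.1/R10.1, superseding the provisional
`YZ26-BF-equiv` / `YZ26@3-r1-BCK-analogy`) as in the module docstring. With this form the residual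
sub-class of the census class X10 is literally `ClassX10 W 3 ∧ ¬ BigIm W 3`.
[cite: YanZhu2024MainConjNonCM, Thm. 4.15 (§4.6) = Cor. 1.4 (§1.1), hypothesis (Im)] -/
def thm415_padicValRat_bsd_rank_le_one_of_bigIm : Prop :=
  ∀ (W : WeierstrassCurve ℚ) [W.IsElliptic] [W.IsGloballyMinimal] (p : ℕ) [Fact p.Prime]
    (_hp : 3 ≤ p) (_hgood : W.HasGoodReductionAtPrime p) (_hord : ¬ (p : ℤ) ∣ W.frobeniusTrace p)
    (_hirr : W.HasIrreducibleModPGaloisRep p)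
    (_hIm : Literature.NumberTheory.EllipticCurves.Rank1Residual.BigIm W p)
    (_hr : W.analyticRank ≤ 1),
    Finite W.sha ∧
      ∃ q : ℚ, W.leadingLCoeff = (((q : ℝ) * W.regulator * W.realPeriodRat : ℝ) : ℂ) ∧
        padicValRat p q = (padicValNat p W.shaOrder : ℤ) + padicValNat p W.tamagawaProduct -
          2 * padicValNat p W.torsionOrder

end Literature.NumberTheory.EllipticCurves.YanZhu2026

end
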